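import Literature.AnabelianGeometry.EtaleTheta.BarDeltaOfSetting
import Literature.AnabelianGeometry.EtaleTheta.Discharge.Sec2DtpYThetaAbelianCorollaries
import HarnessLib

/-!
# [EtTh] §2 over §1: "`Δ_Θ` = the image of `∧² Δ^ell_X`" at the level of `Δ̄_X` — the preimage of `Δ̄_Θ` is
# `⁅Δ^tp_X, Δ^tp_X⁆ · Ker(Δ^tp_X ↠ Δ̄_X)` (proof-only; the model form of the binder `hΘ`, GAP-LEDGER G-L2d3-1)

Mochizuki, *The étale theta function and its Frobenioid-theoretic manifestations*, Publ. RIMS **45**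
(2009), §1 p. 12: "`Δ_Θ` […] the image of `∧² Δ^ell_X` in `Δ^Θ_X`"; §2 p. 35: "`1 → Δ̄_Θ → Δ̄_X → Δ̄^ell_X
→ 1`" [cite: MochizukiEtTh2009, Def 2.1 p.35].

Cell abc-iut, layer L2, W3-L2-02 phase 1 (seat abc-iut-L2-d3). PROOF-ONLY companion (no `def`) of
`BarDeltaOfSetting.lean`. The binder `hΘ : ⁅Δ_X, Δ_X⁆ ⊔ barKer = barTheta` of the abstract Rmk. 2.6.1 /
Cor. 2.9 discharges over `ThetaCovers.TemperedCoverData` (`rmk261_of`, `cor29_card_undotted_of`,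
`nonempty_autK_tpPiXuu_mulEquiv`; GAP-LEDGER G-L2d3-1) HOLDS at the §1 model in its tempered form:

* `commutator_sup_barKerTp_eq` — **`⁅Δ^tp_X, Δ^tp_X⁆ ⊔ Ker(Δ^tp_X ↠ Δ̄_X) = ` the preimage of `Δ̄_Θ`**,
  under the freeness guard `IsEtThOrigin` and the §2-chain binder `hYcl` (every element of `Δ_Θ` is a
  commutator `θ[z₁, y]`, `exists_commutator_of_mem_deltaTheta_of_origin`, seat abc-iut-L5-t14 /
  abc-iut-L2-t10 lineage); the inclusion `≤` is unconditional (`commutator_sup_barKerTp_le`).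

HONEST FRAMING: `hYcl` (GAP-LEDGER G-w4d021-2) is a named hypothesis, not derivable from `Setting` v3;
nothing is asserted about an actual curve; no side is taken on [IUTchIII] Cor. 3.12; typed ≠ proved.
-/

noncomputable section

namespace Literature.AnabelianGeometry.EtaleTheta

open Literature.AnabelianGeometry.SemiGraphs

namespace ThetaSetting

variable {p : ℕ} [Fact p.Prime] (D : ThetaSetting p) (l : ℕ)

/-- Every element of `Δ_Θ` is the image of a commutator of `Δ^tp_X` (under `IsEtThOrigin` + `hYcl`):
repackaging of `exists_commutator_of_mem_deltaTheta_of_origin` with the `Z`-generator supplied by the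
root field `toZ_delta_surjective`. [cite: MochizukiEtTh2009, §1 p.12] -/
theorem exists_commutator_toTheta_eq_of_origin (hO : D.IsEtThOrigin)
    (hYcl : (D.DtpY.map D.toHat.toMonoidHom).topologicalClosure ≤
      D.DtpY.map D.toHat.toMonoidHom ⊔ (⁅⁅D.DeltaHat, D.DeltaHat⁆, D.DeltaHat⁆).topologicalClosure)
    {s : D.GtpTheta} (hs : s ∈ D.DeltaTheta) :
    ∃ c ∈ ⁅D.DeltaTemp, D.DeltaTemp⁆, D.toTheta c = s := by
  obtain ⟨⟨z₁, hz₁⟩, hz₁Z⟩ := D.toZ_delta_surjective (Multiplicative.ofAdd 1)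
  have hz₁Z' : D.toZ z₁ = Multiplicative.ofAdd 1 := hz₁Z
  obtain ⟨y, hy, hys⟩ := D.exists_commutator_of_mem_deltaTheta_of_origin hO hYcl hz₁ hz₁Z' hs
  refine ⟨z₁ * y * z₁⁻¹ * y⁻¹, ?_, hys⟩
  have h := Subgroup.commutator_mem_commutator hz₁ (Subgroup.mem_inf.1 hy).2
  rwa [commutatorElement_def] at h

/-- **`⁅Δ^tp_X, Δ^tp_X⁆ · Ker(Δ^tp_X ↠ Δ̄_X) = ` the preimage of `Δ̄_Θ`** ("`Δ_Θ` is the image of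
`∧² Δ^ell_X`", p. 12, read in `Δ̄_X`): the model form, at the tempered level, of the binder `hΘ` of
`TemperedCoverData.rmk261_of` (GAP-LEDGER G-L2d3-1), under `IsEtThOrigin` and `hYcl`.
[cite: MochizukiEtTh2009, Def 2.1 p.35] -/
theorem commutator_sup_barKerTp_eq (hO : D.IsEtThOrigin)
    (hYcl : (D.DtpY.map D.toHat.toMonoidHom).topologicalClosure ≤
      D.DtpY.map D.toHat.toMonoidHom ⊔ (⁅⁅D.DeltaHat, D.DeltaHat⁆, D.DeltaHat⁆).topologicalClosure) :
    ⁅D.DeltaTemp, D.DeltaTemp⁆ ⊔ D.barKerTp l = D.barThetaTp l := by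
  refine le_antisymm (D.commutator_sup_barKerTp_le l) fun t ht => ?_
  have htΔ : t ∈ D.DeltaTemp := ((D.mem_barThetaTp_iff l).1 ht).1
  have htΘ : D.toTheta t ∈ D.powTheta l ⊔ D.DeltaTheta := ((D.mem_barThetaTp_iff l).1 ht).2
  haveI := D.powTheta_normal l
  obtain ⟨q, hq, s, hs, hqs⟩ := Subgroup.mem_sup_of_normal_left.1 htΘ
  obtain ⟨c, hc, hcs⟩ := D.exists_commutator_toTheta_eq_of_origin hO hYcl hs
  have hcΔ : c ∈ D.DeltaTemp := by
    refine (Subgroup.commutator_le.2 fun a ha b hb => ?_) hc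
    rw [commutatorElement_def]
    exact mul_mem (mul_mem (mul_mem ha hb) (inv_mem ha)) (inv_mem hb)
  -- `t = (t c⁻¹) · c` with `θ(t c⁻¹) = q ∈ ⟨l-th powers⟩`
  have hker : t * c⁻¹ ∈ D.barKerTp l := by
    refine (D.mem_barKerTp_iff l).2 ⟨mul_mem htΔ (inv_mem hcΔ), ?_⟩
    rw [map_mul, map_inv, hcs, ← hqs, mul_inv_cancel_right]
    exact hq
  have e : t = t * c⁻¹ * c := by group
  rw [e]
  exact mul_mem (Subgroup.mem_sup_right hker) (Subgroup.mem_sup_left hc)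

end ThetaSetting

end Literature.AnabelianGeometry.EtaleTheta

end
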